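import Summits.Ventures.Crystal3D.Theorems.StickyWulffConstantCoaxialWallLawWordRigidityMulti
import Summits.Ventures.Crystal3D.Theorems.StickyWulffConstantCoaxialWallLawEndUnique
import HarnessLib

/-!
# LEMMA X: moving states of two DIFFERENT root families at one ball never share their target

HONEST FRAMING. Part of the venture `Summits/Ventures/Crystal3D` (cell `crystal3d-full`), helper for the crux
`CoaxialWallLaw` (stmt-Ventures-19481) of `route-Ventures-StickyWulffConstant`, REGISTERED line `WallLedgerF`
(planner cf-p1), open stub `stub_coaxialTwoSlabAdhesion` (general fillings).  Rung credit only; F-C1 not moved.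
Brick (B2) of memo HOME/wall-19481-p2/F-MULTISOURCE.md (19481-p2 g4): the census-free end charging injects the end
states at a ball into its contact neighbours through their PREDECESSOR balls; within ONE root family distinct reached
states have distinct predecessors (`word_reached_pred_ne`).  Sourcing SEVERAL root families with the SAME capacity needs:

**Theorem (`word_target_ne_of_roots_ne`, LEMMA X).**  Shared letter model `F` (`hFc`), two menu-chain words `κ₁, κ₂`
(`word_letters_of_wf` for either root), root slots `r₁ ≠ ±r₂`, directions `dᵢ = F κᵢ ((−1)^{|κᵢ|} rᵢ)`, one ball `p` of a
`1`-separated `X` at which family `i` MOVES — full `F κᵢ`-shell (target `p + dᵢ`), or a twin reading `(F κᵢ, mᵢ)` with a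
CROSS (`⟪dᵢ, mᵢ⟫ = √(2/3)`, target `p − R_{mᵢ} dᵢ`) or a GLIDE (`⟪dᵢ, mᵢ⟫ = 0`, target `p + dᵢ`).  Then the targets differ.
Proof (only `1`-separation): full/full ⇒ shared triangle ⇒ equal frame maps and lengths (B1) ⇒ `d₁ ≠ d₂`; full/twin ⇒
equal frames but the reading's positive slots are EMPTY; twin/twin ⇒ the occupied negative face of `m₂` lies in the own
or the mirrored dozen of `(F κ₁, m₁)` (`triangle_own_or_mirror_of_twinDozen`): own ⇒ equal frames, `m₁ = m₂`
(`twinDozen_normal_eq_self`), offsets `{d, −R_m d}` never agree; mirrored ⇒ `F κ₂ = R_{m₁} ∘ F κ₁`, opposite parity,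
`m₂ = −m₁`, and the four combinations force `r₁ = ±r₂` or `⟪r₁, r₂⟫ = ±1/3` (`reflect_oblique_ne_slot`).
The predecessor form follows in the instance from `word_move_target` (brick B3).

WHAT THIS IS NOT: not the stub; the multi-root instance (Σ over roots ≤ 78·#PAY + rims) is brick B3; F-C1 not moved.
-/

noncomputable section

namespace Summit.Ventures.Crystal3D.Theorems

open Summit.Ventures.Crystal3D Finset
open scoped InnerProductSpace

variable {X : Finset (EuclideanSpace ℝ (Fin 3))}

/-- The slot menu of `−m` is the slot menu of `m`. -/
theorem menu_neg (G : EuclideanSpace ℝ (Fin 3) ≃ₗᵢ[ℝ] EuclideanSpace ℝ (Fin 3)) {m : EuclideanSpace ℝ (Fin 3)}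
    (hmenu : ∀ w ∈ fccSlots, ⟪G w, m⟫_ℝ = 0 ∨ ⟪G w, m⟫_ℝ = Real.sqrt (2 / 3) ∨ ⟪G w, m⟫_ℝ = -Real.sqrt (2 / 3)) :
    ∀ w ∈ fccSlots, ⟪G w, -m⟫_ℝ = 0 ∨ ⟪G w, -m⟫_ℝ = Real.sqrt (2 / 3) ∨ ⟪G w, -m⟫_ℝ = -Real.sqrt (2 / 3) := by
  intro w hw
  rw [inner_neg_right]
  rcases hmenu w hw with h | h | h
  · exact Or.inl (by rw [h, neg_zero])
  · exact Or.inr (Or.inr (by rw [h]))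
  · exact Or.inr (Or.inl (by rw [h, neg_neg]))

/-- The mirror flips the `m`-component: `⟪R_m x, m⟫ = −⟪x, m⟫`. -/
theorem inner_mirror_self {m : EuclideanSpace ℝ (Fin 3)} (hm : ‖m‖ = 1) (x : EuclideanSpace ℝ (Fin 3)) :
    ⟪x - (2 * ⟪x, m⟫_ℝ) • m, m⟫_ℝ = -⟪x, m⟫_ℝ := by
  rw [inner_sub_left, real_inner_smul_left, real_inner_self_eq_norm_sq, hm]; ring

/-- **A slot mirrored across an OBLIQUE model menu normal is neither a slot nor the negative of one**: if
`⟪r, μ⟫ = ±√(2/3)` then `R_μ r ≠ ±r'` for all slots `r'` (`⟪R_μ r, r⟫ = −1/3` is not an angle between slots). -/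
theorem reflect_oblique_ne_slot {r r' μ : EuclideanSpace ℝ (Fin 3)} (hr : r ∈ fccSlots) (hr' : r' ∈ fccSlots)
    (hμ : ⟪r, μ⟫_ℝ = Real.sqrt (2 / 3) ∨ ⟪r, μ⟫_ℝ = -Real.sqrt (2 / 3)) :
    r - (2 * ⟪r, μ⟫_ℝ) • μ ≠ r' ∧ r - (2 * ⟪r, μ⟫_ℝ) • μ ≠ -r' := by
  have h23 : Real.sqrt (2 / 3) ^ 2 = 2 / 3 := Real.sq_sqrt (by norm_num)
  have hsq : ⟪r, μ⟫_ℝ ^ 2 = 2 / 3 := by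
    rcases hμ with h | h
    · rw [h]; exact h23
    · rw [h, neg_sq]; exact h23
  have key : ⟪r - (2 * ⟪r, μ⟫_ℝ) • μ, r⟫_ℝ = -(1 / 3) := by
    rw [inner_sub_left, real_inner_smul_left, real_inner_self_eq_norm_sq, norm_eq_one_of_mem_fccSlots hr,
      real_inner_comm r μ]
    nlinarith [hsq]
  constructor
  · intro h
    rw [h] at key
    rcases inner_slots_mem hr' hr with e | e | e | e | e <;> rw [e] at key <;> norm_num at key
  · intro h
    rw [h, inner_neg_left] at key
    rcases inner_slots_mem hr' hr with e | e | e | e | e <;> rw [e] at key <;> norm_num at key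

open scoped Classical in
/-- **A `60°` triangle of contacts of a twin-reading ball lies in the own or in the mirrored dozen** (the geometry
of `word_class_of_twinDozen`, without the rigidity step). -/
theorem triangle_own_or_mirror_of_twinDozen (hX : ∀ p ∈ X, ∀ q ∈ X, p ≠ q → 1 ≤ dist p q)
    (G : EuclideanSpace ℝ (Fin 3) ≃ₗᵢ[ℝ] EuclideanSpace ℝ (Fin 3)) {m : EuclideanSpace ℝ (Fin 3)} (hm : ‖m‖ = 1)
    (hmenu : ∀ w ∈ fccSlots, ⟪G w, m⟫_ℝ = 0 ∨ ⟪G w, m⟫_ℝ = Real.sqrt (2 / 3) ∨ ⟪G w, m⟫_ℝ = -Real.sqrt (2 / 3))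
    {p : EuclideanSpace ℝ (Fin 3)}
    (hown : ∀ w ∈ fccSlots, ⟪G w, m⟫_ℝ ≤ 0 → p + G w ∈ X)
    (hmir : ∀ w ∈ fccSlots, ⟪G w, m⟫_ℝ < 0 → p + (G w - (2 * ⟪G w, m⟫_ℝ) • m) ∈ X)
    (G' : EuclideanSpace ℝ (Fin 3) ≃ₗᵢ[ℝ] EuclideanSpace ℝ (Fin 3))
    {a a' a'' : EuclideanSpace ℝ (Fin 3)} (ha : a ∈ fccSlots) (ha' : a' ∈ fccSlots) (ha'' : a'' ∈ fccSlots)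
    (i1 : ⟪a, a'⟫_ℝ = 1 / 2) (i2 : ⟪a, a''⟫_ℝ = 1 / 2) (i3 : ⟪a', a''⟫_ℝ = 1 / 2)
    (h1 : p + G' a ∈ X) (h2 : p + G' a' ∈ X) (h3 : p + G' a'' ∈ X) :
    ((∃ w ∈ fccSlots, G w = G' a) ∧ (∃ w ∈ fccSlots, G w = G' a') ∧ (∃ w ∈ fccSlots, G w = G' a'')) ∨
    (G' a ∈ ((G.trans (ℝ ∙ m)ᗮ.reflection : EuclideanSpace ℝ (Fin 3) → EuclideanSpace ℝ (Fin 3)) '' ↑fccSlots) ∧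
     G' a' ∈ ((G.trans (ℝ ∙ m)ᗮ.reflection : EuclideanSpace ℝ (Fin 3) → EuclideanSpace ℝ (Fin 3)) '' ↑fccSlots) ∧
     G' a'' ∈ ((G.trans (ℝ ∙ m)ᗮ.reflection : EuclideanSpace ℝ (Fin 3) → EuclideanSpace ℝ (Fin 3)) '' ↑fccSlots)) := by
  have h23 : Real.sqrt (2 / 3) ^ 2 = 2 / 3 := Real.sq_sqrt (by norm_num)
  set L : EuclideanSpace ℝ (Fin 3) ≃ₗᵢ[ℝ] EuclideanSpace ℝ (Fin 3) := G.trans (ℝ ∙ m)ᗮ.reflection with hL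
  have hLapp : ∀ x, L x = G x - (2 * ⟪G x, m⟫_ℝ) • m := fun x => by
    rw [hL, LinearIsometryEquiv.trans_apply, reflection_unit_apply hm]
  have hvert : ∀ {x : EuclideanSpace ℝ (Fin 3)}, x ∈ fccSlots → p + G' x ∈ X →
      (∃ w ∈ fccSlots, ⟪G w, m⟫_ℝ ≤ 0 ∧ G' x = G w) ∨
        (∃ w ∈ fccSlots, ⟪G w, m⟫_ℝ < 0 ∧ G' x = G w - (2 * ⟪G w, m⟫_ℝ) • m) := by
    intro x hx hxX
    have hdist : dist p (p + G' x) = 1 := by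
      rw [dist_self_add_right, LinearIsometryEquiv.norm_map, norm_eq_one_of_mem_fccSlots hx]
    rcases mem_shell_of_twinDozen hX G hm hown hmir hxX hdist with ⟨w, hw, hle, he⟩ | ⟨w, hw, hlt, he⟩
    · exact Or.inl ⟨w, hw, hle, (add_left_cancel he).symm ▸ rfl⟩
    · exact Or.inr ⟨w, hw, hlt, (add_left_cancel he).symm ▸ rfl⟩
  have hnomix : ∀ {x x' : EuclideanSpace ℝ (Fin 3)}, ⟪x, x'⟫_ℝ = 1 / 2 → x ∈ fccSlots → x' ∈ fccSlots →
      ∀ {w w' : EuclideanSpace ℝ (Fin 3)}, w ∈ fccSlots → w' ∈ fccSlots →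
      ⟪G w, m⟫_ℝ < 0 → G' x = G w - (2 * ⟪G w, m⟫_ℝ) • m →
      ⟪G w', m⟫_ℝ ≤ 0 → G' x' = G w' → ⟪G w', m⟫_ℝ = 0 := by
    intro x x' hxx' hx hx' w w' hw hw' hlt he hle he'
    rcases hmenu w' hw' with h0 | hp | hn
    · exact h0
    · rw [hp] at hle; linarith [Real.sqrt_pos.2 (show (0 : ℝ) < 2 / 3 by norm_num)]
    · exfalso
      have hwn : ⟪G w, m⟫_ℝ = -Real.sqrt (2 / 3) := by
        rcases hmenu w hw with h0 | hp | hn'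
        · rw [h0] at hlt; exact absurd hlt (lt_irrefl 0)
        · rw [hp] at hlt; linarith [Real.sqrt_pos.2 (show (0 : ℝ) < 2 / 3 by norm_num)]
        · exact hn'
      have key : ⟪G' x, G' x'⟫_ℝ = ⟪w, w'⟫_ℝ - 4 / 3 := by
        rw [he, he', inner_sub_left, real_inner_smul_left, LinearIsometryEquiv.inner_map_map,
          real_inner_comm (G w'), hwn, hn]
        nlinarith [h23]
      rw [LinearIsometryEquiv.inner_map_map, hxx'] at key
      have hb : ⟪w, w'⟫_ℝ ≤ 1 := by
        have := real_inner_le_norm w w'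
        rwa [norm_eq_one_of_mem_fccSlots hw, norm_eq_one_of_mem_fccSlots hw', one_mul] at this
      linarith
  have hexL : ∀ {x w' : EuclideanSpace ℝ (Fin 3)}, w' ∈ fccSlots → ⟪G w', m⟫_ℝ = 0 → G' x = G w' →
      G' x ∈ (L : EuclideanSpace ℝ (Fin 3) → EuclideanSpace ℝ (Fin 3)) '' ↑fccSlots := by
    intro x w' hw' h0 he'
    refine ⟨w', Finset.mem_coe.2 hw', ?_⟩
    rw [hLapp, h0, mul_zero, zero_smul, sub_zero, he']
  have hmirL : ∀ {x w : EuclideanSpace ℝ (Fin 3)}, w ∈ fccSlots → G' x = G w - (2 * ⟪G w, m⟫_ℝ) • m →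
      G' x ∈ (L : EuclideanSpace ℝ (Fin 3) → EuclideanSpace ℝ (Fin 3)) '' ↑fccSlots := by
    intro x w hw he
    exact ⟨w, Finset.mem_coe.2 hw, by rw [hLapp, he]⟩
  have i21 : ⟪a', a⟫_ℝ = 1 / 2 := by rw [real_inner_comm]; exact i1
  have i31 : ⟪a'', a⟫_ℝ = 1 / 2 := by rw [real_inner_comm]; exact i2
  have i32 : ⟪a'', a'⟫_ℝ = 1 / 2 := by rw [real_inner_comm]; exact i3
  rcases hvert ha h1 with ⟨w₁, hw₁, hle₁, e₁⟩ | ⟨w₁, hw₁, hlt₁, e₁⟩ <;>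
    rcases hvert ha' h2 with ⟨w₂, hw₂, hle₂, e₂⟩ | ⟨w₂, hw₂, hlt₂, e₂⟩ <;>
    rcases hvert ha'' h3 with ⟨w₃, hw₃, hle₃, e₃⟩ | ⟨w₃, hw₃, hlt₃, e₃⟩
  · exact Or.inl ⟨⟨w₁, hw₁, e₁.symm⟩, ⟨w₂, hw₂, e₂.symm⟩, ⟨w₃, hw₃, e₃.symm⟩⟩
  all_goals right; refine ⟨?_, ?_, ?_⟩
  · exact hexL hw₁ (hnomix i31 ha'' ha hw₃ hw₁ hlt₃ e₃ hle₁ e₁) e₁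
  · exact hexL hw₂ (hnomix i32 ha'' ha' hw₃ hw₂ hlt₃ e₃ hle₂ e₂) e₂
  · exact hmirL hw₃ e₃
  · exact hexL hw₁ (hnomix i21 ha' ha hw₂ hw₁ hlt₂ e₂ hle₁ e₁) e₁
  · exact hmirL hw₂ e₂
  · exact hexL hw₃ (hnomix i3 ha' ha'' hw₂ hw₃ hlt₂ e₂ hle₃ e₃) e₃
  · exact hexL hw₁ (hnomix i21 ha' ha hw₂ hw₁ hlt₂ e₂ hle₁ e₁) e₁
  · exact hmirL hw₂ e₂
  · exact hmirL hw₃ e₃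
  · exact hmirL hw₁ e₁
  · exact hexL hw₂ (hnomix i1 ha ha' hw₁ hw₂ hlt₁ e₁ hle₂ e₂) e₂
  · exact hexL hw₃ (hnomix i2 ha ha'' hw₁ hw₃ hlt₁ e₁ hle₃ e₃) e₃
  · exact hmirL hw₁ e₁
  · exact hexL hw₂ (hnomix i1 ha ha' hw₁ hw₂ hlt₁ e₁ hle₂ e₂) e₂
  · exact hmirL hw₃ e₃
  · exact hmirL hw₁ e₁
  · exact hmirL hw₂ e₂
  · exact hexL hw₃ (hnomix i2 ha ha'' hw₁ hw₃ hlt₁ e₁ hle₃ e₃) e₃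
  · exact hmirL hw₁ e₁
  · exact hmirL hw₂ e₂
  · exact hmirL hw₃ e₃

section TwoFamilies

variable {F : List (EuclideanSpace ℝ (Fin 3)) → (EuclideanSpace ℝ (Fin 3) ≃ₗᵢ[ℝ] EuclideanSpace ℝ (Fin 3))}

/-- **A full shell and a twin reading of two menu-chain frames never sit at one ball**: the frames would share a
triangle, hence agree as maps, and the twin reading's positive slots are empty while the shell is full. -/
theorem word_full_twin_false (hX : ∀ p ∈ X, ∀ q ∈ X, p ≠ q → 1 ≤ dist p q)
    (hFc : ∀ μ κ, F (μ :: κ) = ((ℝ ∙ μ)ᗮ.reflection).trans (F κ))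
    {κ κ' : List (EuclideanSpace ℝ (Fin 3))}
    (hκ : ∀ μ ∈ κ, ‖μ‖ = 1 ∧
      ∀ w ∈ fccSlots, ⟪w, μ⟫_ℝ = 0 ∨ ⟪w, μ⟫_ℝ = Real.sqrt (2 / 3) ∨ ⟪w, μ⟫_ℝ = -Real.sqrt (2 / 3))
    (hκ' : ∀ μ ∈ κ', ‖μ‖ = 1 ∧
      ∀ w ∈ fccSlots, ⟪w, μ⟫_ℝ = 0 ∨ ⟪w, μ⟫_ℝ = Real.sqrt (2 / 3) ∨ ⟪w, μ⟫_ℝ = -Real.sqrt (2 / 3))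
    (hch : List.IsChain (fun μ μ' => ⟪μ, μ'⟫_ℝ = 1 / 3 ∨ ⟪μ, μ'⟫_ℝ = -1 / 3) κ)
    (hch' : List.IsChain (fun μ μ' => ⟪μ, μ'⟫_ℝ = 1 / 3 ∨ ⟪μ, μ'⟫_ℝ = -1 / 3) κ')
    {p : EuclideanSpace ℝ (Fin 3)} (hfull : ∀ w ∈ fccSlots, p + F κ w ∈ X)
    {m : EuclideanSpace ℝ (Fin 3)} (hm : ‖m‖ = 1)
    (hmenu : ∀ w ∈ fccSlots, ⟪F κ' w, m⟫_ℝ = 0 ∨ ⟪F κ' w, m⟫_ℝ = Real.sqrt (2 / 3) ∨ ⟪F κ' w, m⟫_ℝ = -Real.sqrt (2 / 3))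
    (hown : ∀ w ∈ fccSlots, ⟪F κ' w, m⟫_ℝ ≤ 0 → p + F κ' w ∈ X)
    (hemp : ∀ w ∈ fccSlots, 0 < ⟪F κ' w, m⟫_ℝ → p + F κ' w ∉ X) : False := by
  have hr : 0 < Real.sqrt (2 / 3) := Real.sqrt_pos.2 (by norm_num)
  have hm' : ‖-m‖ = 1 := by rw [norm_neg, hm]
  obtain ⟨a, ha, b, hb, c, hc, hna, hnb, hnc, iab, iac, ibc, -, -⟩ := exists_far_frame (F κ') hm' (menu_neg (F κ') hmenu)
  have hocc : ∀ {x : EuclideanSpace ℝ (Fin 3)}, x ∈ fccSlots → ⟪F κ' x, -m⟫_ℝ = Real.sqrt (2 / 3) →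
      ∃ w ∈ fccSlots, F κ w = F κ' x := by
    intro x hx hxm
    rw [inner_neg_right] at hxm
    have hX' : p + F κ' x ∈ X := hown x hx (by linarith)
    exact shell_slot_of_full hX (F κ) hfull hX' (by rw [LinearIsometryEquiv.norm_map, norm_eq_one_of_mem_fccSlots hx])
  obtain ⟨-, hmap⟩ := word_frame_eq_of_triangle_of_chain hFc hκ' hκ hch' hch
    ⟨a, ha, b, hb, c, hc, iab, iac, ibc, hocc ha hna, hocc hb hnb, hocc hc hnc⟩
  obtain ⟨aP, haP, -, -, -, -, hpa, -⟩ := exists_far_frame (F κ') hm hmenu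
  exact hemp aP haP (by rw [hpa]; exact hr) (by rw [hmap aP]; exact hfull aP haP)

/-- **LEMMA X.**  Moving states of two different root families at one ball have different targets.  See the module
docstring. -/
theorem word_target_ne_of_roots_ne (hX : ∀ p ∈ X, ∀ q ∈ X, p ≠ q → 1 ≤ dist p q)
    (hFc : ∀ μ κ, F (μ :: κ) = ((ℝ ∙ μ)ᗮ.reflection).trans (F κ))
    {κ₁ κ₂ : List (EuclideanSpace ℝ (Fin 3))}
    (hκ₁ : ∀ μ ∈ κ₁, ‖μ‖ = 1 ∧
      ∀ w ∈ fccSlots, ⟪w, μ⟫_ℝ = 0 ∨ ⟪w, μ⟫_ℝ = Real.sqrt (2 / 3) ∨ ⟪w, μ⟫_ℝ = -Real.sqrt (2 / 3))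
    (hκ₂ : ∀ μ ∈ κ₂, ‖μ‖ = 1 ∧
      ∀ w ∈ fccSlots, ⟪w, μ⟫_ℝ = 0 ∨ ⟪w, μ⟫_ℝ = Real.sqrt (2 / 3) ∨ ⟪w, μ⟫_ℝ = -Real.sqrt (2 / 3))
    (hch₁ : List.IsChain (fun μ μ' => ⟪μ, μ'⟫_ℝ = 1 / 3 ∨ ⟪μ, μ'⟫_ℝ = -1 / 3) κ₁)
    (hch₂ : List.IsChain (fun μ μ' => ⟪μ, μ'⟫_ℝ = 1 / 3 ∨ ⟪μ, μ'⟫_ℝ = -1 / 3) κ₂)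
    {r₁ r₂ : EuclideanSpace ℝ (Fin 3)} (hr₁ : r₁ ∈ fccSlots) (hr₂ : r₂ ∈ fccSlots) (hne : r₁ ≠ r₂) (hne' : r₁ ≠ -r₂)
    {d₁ d₂ : EuclideanSpace ℝ (Fin 3)} (hd₁ : d₁ = F κ₁ (((-1 : ℝ) ^ κ₁.length) • r₁))
    (hd₂ : d₂ = F κ₂ (((-1 : ℝ) ^ κ₂.length) • r₂))
    {p t₁ t₂ : EuclideanSpace ℝ (Fin 3)}
    (hT₁ : ((∀ w ∈ fccSlots, p + F κ₁ w ∈ X) ∧ t₁ = p + d₁) ∨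
      ∃ m : EuclideanSpace ℝ (Fin 3), ‖m‖ = 1 ∧
        (∀ w ∈ fccSlots, ⟪F κ₁ w, m⟫_ℝ = 0 ∨ ⟪F κ₁ w, m⟫_ℝ = Real.sqrt (2 / 3) ∨ ⟪F κ₁ w, m⟫_ℝ = -Real.sqrt (2 / 3)) ∧
        (∀ w ∈ fccSlots, ⟪F κ₁ w, m⟫_ℝ ≤ 0 → p + F κ₁ w ∈ X) ∧
        (∀ w ∈ fccSlots, ⟪F κ₁ w, m⟫_ℝ < 0 → p + (F κ₁ w - (2 * ⟪F κ₁ w, m⟫_ℝ) • m) ∈ X) ∧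
        (∀ w ∈ fccSlots, 0 < ⟪F κ₁ w, m⟫_ℝ → p + F κ₁ w ∉ X) ∧
        ((⟪d₁, m⟫_ℝ = Real.sqrt (2 / 3) ∧ t₁ = p - (d₁ - (2 * ⟪d₁, m⟫_ℝ) • m)) ∨ (⟪d₁, m⟫_ℝ = 0 ∧ t₁ = p + d₁)))
    (hT₂ : ((∀ w ∈ fccSlots, p + F κ₂ w ∈ X) ∧ t₂ = p + d₂) ∨
      ∃ m : EuclideanSpace ℝ (Fin 3), ‖m‖ = 1 ∧
        (∀ w ∈ fccSlots, ⟪F κ₂ w, m⟫_ℝ = 0 ∨ ⟪F κ₂ w, m⟫_ℝ = Real.sqrt (2 / 3) ∨ ⟪F κ₂ w, m⟫_ℝ = -Real.sqrt (2 / 3)) ∧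
        (∀ w ∈ fccSlots, ⟪F κ₂ w, m⟫_ℝ ≤ 0 → p + F κ₂ w ∈ X) ∧
        (∀ w ∈ fccSlots, ⟪F κ₂ w, m⟫_ℝ < 0 → p + (F κ₂ w - (2 * ⟪F κ₂ w, m⟫_ℝ) • m) ∈ X) ∧
        (∀ w ∈ fccSlots, 0 < ⟪F κ₂ w, m⟫_ℝ → p + F κ₂ w ∉ X) ∧
        ((⟪d₂, m⟫_ℝ = Real.sqrt (2 / 3) ∧ t₂ = p - (d₂ - (2 * ⟪d₂, m⟫_ℝ) • m)) ∨ (⟪d₂, m⟫_ℝ = 0 ∧ t₂ = p + d₂))) :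
    t₁ ≠ t₂ := by
  have hr : 0 < Real.sqrt (2 / 3) := Real.sqrt_pos.2 (by norm_num)
  have h23 : Real.sqrt (2 / 3) ^ 2 = 2 / 3 := Real.sq_sqrt (by norm_num)
  set ε₁ : ℝ := (-1 : ℝ) ^ κ₁.length with hε₁
  set ε₂ : ℝ := (-1 : ℝ) ^ κ₂.length with hε₂
  have hε₁sq : ε₁ * ε₁ = 1 := by rcases neg_one_pow_eq_or ℝ κ₁.length with h | h <;> rw [hε₁, h] <;> norm_num
  have hε₁0 : ε₁ ≠ 0 := fun h => by rw [h, mul_zero] at hε₁sq; exact zero_ne_one hε₁sq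
  have hpar_eq : κ₁.length = κ₂.length → ε₂ = ε₁ := fun h => by rw [hε₂, ← h]
  have hpar_ne : (κ₁.length + κ₂.length) % 2 = 1 → ε₂ = -ε₁ := by
    intro h
    have hodd : ε₁ * ε₂ = -1 := by rw [hε₁, hε₂, ← pow_add]; exact Odd.neg_one_pow (Nat.odd_iff.2 h)
    have : ε₁ * (ε₁ * ε₂) = ε₁ * (-1) := by rw [hodd]
    rw [← mul_assoc, hε₁sq, one_mul, mul_neg_one] at this
    exact this
  have hdiff : ∀ (Φ : EuclideanSpace ℝ (Fin 3) ≃ₗᵢ[ℝ] EuclideanSpace ℝ (Fin 3)), Φ (ε₁ • r₁) ≠ Φ (ε₁ • r₂) := by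
    intro Φ h
    have := smul_right_injective _ hε₁0 (Φ.injective h)
    exact hne this
  intro heq
  rcases hT₁ with ⟨full₁, rfl⟩ | ⟨m₁, hm₁, menu₁, own₁, mir₁, emp₁, hc₁⟩ <;>
    rcases hT₂ with ⟨full₂, ht₂⟩ | ⟨m₂, hm₂, menu₂, own₂, mir₂, emp₂, hc₂⟩
  · -- full / full
    obtain ⟨n, hn, hnmenu, -⟩ := exists_menuNormal_far (F κ₂) hr₂
    obtain ⟨a, ha, b, hb, c, hc, -, -, -, iab, iac, ibc, -, -⟩ := exists_far_frame (F κ₂) hn hnmenu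
    have hocc : ∀ {x : EuclideanSpace ℝ (Fin 3)}, x ∈ fccSlots → ∃ w ∈ fccSlots, F κ₁ w = F κ₂ x := fun {x} hx =>
      shell_slot_of_full hX (F κ₁) full₁ (full₂ x hx) (by rw [LinearIsometryEquiv.norm_map, norm_eq_one_of_mem_fccSlots hx])
    obtain ⟨hlen, hmap⟩ := word_frame_eq_of_triangle_of_chain hFc hκ₂ hκ₁ hch₂ hch₁
      ⟨a, ha, b, hb, c, hc, iab, iac, ibc, hocc ha, hocc hb, hocc hc⟩
    rw [ht₂, hd₁, hd₂, hmap, hpar_eq hlen.symm] at heq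
    exact hdiff (F κ₁) (add_left_cancel heq)
  · -- full / twin
    exact word_full_twin_false hX hFc hκ₁ hκ₂ hch₁ hch₂ full₁ hm₂ menu₂ own₂ emp₂
  · -- twin / full
    exact word_full_twin_false hX hFc hκ₂ hκ₁ hch₂ hch₁ full₂ hm₁ menu₁ own₁ emp₁
  · -- twin / twin: the occupied negative face of `m₂` inside the `(F κ₁, m₁)` reading
    have hm₂' : ‖-m₂‖ = 1 := by rw [norm_neg, hm₂]
    obtain ⟨a, ha, b, hb, c, hc, hna, hnb, hnc, iab, iac, ibc, -, -⟩ :=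
      exists_far_frame (F κ₂) hm₂' (menu_neg (F κ₂) menu₂)
    have hoccX : ∀ {x : EuclideanSpace ℝ (Fin 3)}, x ∈ fccSlots → ⟪F κ₂ x, -m₂⟫_ℝ = Real.sqrt (2 / 3) → p + F κ₂ x ∈ X := by
      intro x hx hxm
      rw [inner_neg_right] at hxm
      exact own₂ x hx (by linarith)
    have hmc : ∀ x, F κ₁ x - (2 * ⟪F κ₁ x, m₁⟫_ℝ) • m₁ = F κ₁ (x - (2 * ⟪x, (F κ₁).symm m₁⟫_ℝ) • (F κ₁).symm m₁) := by
      intro x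
      have := mirror_conj (F κ₁) ((F κ₁).symm m₁) x
      rwa [LinearIsometryEquiv.apply_symm_apply] at this
    rcases triangle_own_or_mirror_of_twinDozen hX (F κ₁) hm₁ menu₁ own₁ mir₁ (F κ₂) ha hb hc iab iac ibc
        (hoccX ha hna) (hoccX hb hnb) (hoccX hc hnc) with ⟨ea, eb, ec⟩ | ⟨ea, eb, ec⟩
    · -- (a) own: equal frames, equal parity, equal normal
      obtain ⟨hlen, hmap⟩ := word_frame_eq_of_triangle_of_chain hFc hκ₂ hκ₁ hch₂ hch₁
        ⟨a, ha, b, hb, c, hc, iab, iac, ibc, ea, eb, ec⟩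
      have hmm : m₁ = m₂ :=
        twinDozen_normal_eq_self (F κ₁) hm₁ hm₂ menu₁ (fun w hw => by rw [← hmap w]; exact menu₂ w hw) own₁
          (fun w hw h => by rw [← hmap w]; exact emp₂ w hw (by rw [hmap w]; exact h))
      have hd₂' : d₂ = F κ₁ (ε₁ • r₂) := by rw [hd₂, hmap, hpar_eq hlen.symm]
      have hd₁' : d₁ = F κ₁ (ε₁ • r₁) := hd₁
      have hdne : d₁ ≠ d₂ := by rw [hd₁', hd₂']; exact hdiff (F κ₁)
      rw [← hmm] at hc₂
      rcases hc₁ with ⟨hx₁, rfl⟩ | ⟨hg₁, rfl⟩ <;> rcases hc₂ with ⟨hx₂, rfl⟩ | ⟨hg₂, rfl⟩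
      · -- cross / cross
        have h := sub_right_injective heq
        have : d₁ = d₂ := by
          have e1 := reflect_reflect_unit hm₁ d₁
          have e2 := reflect_reflect_unit hm₁ d₂
          rw [← e1, ← e2, h]
        exact hdne this
      · -- cross / glide
        have h : -(d₁ - (2 * ⟪d₁, m₁⟫_ℝ) • m₁) = d₂ := by
          have := heq; rw [sub_eq_add_neg] at this; exact add_left_cancel this
        have := congrArg (fun x => ⟪x, m₁⟫_ℝ) h
        simp only [inner_neg_left, inner_mirror_self hm₁] at this
        rw [neg_neg, hx₁, hg₂] at this
        exact hr.ne' this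
      · -- glide / cross
        have h : d₁ = -(d₂ - (2 * ⟪d₂, m₁⟫_ℝ) • m₁) := by
          have := heq; rw [sub_eq_add_neg] at this; exact add_left_cancel this
        have := congrArg (fun x => ⟪x, m₁⟫_ℝ) h
        simp only [inner_neg_left, inner_mirror_self hm₁] at this
        rw [neg_neg, hg₁, hx₂] at this
        exact hr.ne' this.symm
      · -- glide / glide
        exact hdne (add_left_cancel heq)
    · -- (b) mirrored: `F κ₂ = R_{m₁} ∘ F κ₁`, opposite parity, opposite normal
      set μ₁ : EuclideanSpace ℝ (Fin 3) := (F κ₁).symm m₁ with hμ₁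
      have hFμ : F κ₁ μ₁ = m₁ := by rw [hμ₁, LinearIsometryEquiv.apply_symm_apply]
      have hμ₁1 : ‖μ₁‖ = 1 := by rw [hμ₁, LinearIsometryEquiv.norm_map, hm₁]
      have hμ₁m : ∀ w ∈ fccSlots, ⟪w, μ₁⟫_ℝ = 0 ∨ ⟪w, μ₁⟫_ℝ = Real.sqrt (2 / 3) ∨ ⟪w, μ₁⟫_ℝ = -Real.sqrt (2 / 3) := by
        intro w hw; rw [← LinearIsometryEquiv.inner_map_map (F κ₁) w μ₁, hFμ]; exact menu₁ w hw
      have himg : (F κ₂ : EuclideanSpace ℝ (Fin 3) → EuclideanSpace ℝ (Fin 3)) '' ↑fccSlots =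
          (fun x => F κ₁ x - (2 * ⟪F κ₁ x, F κ₁ μ₁⟫_ℝ) • F κ₁ μ₁) '' ↑fccSlots := by
        rw [image_fccSlots_eq_of_triangle (F κ₂) ((F κ₁).trans (ℝ ∙ m₁)ᗮ.reflection) ha hb hc iab iac ibc ea eb ec, hFμ]
        exact Set.image_congr fun x _ => by rw [LinearIsometryEquiv.trans_apply, reflection_unit_apply hm₁]
      obtain ⟨hpar, hmap⟩ := word_frame_eq_cons_of_image_eq_mirror hFc hκ₁ hκ₂ hch₁ hch₂ hμ₁1 hμ₁m himg
      have hmap' : ∀ x, F κ₂ x = F κ₁ x - (2 * ⟪F κ₁ x, m₁⟫_ℝ) • m₁ := fun x => by rw [hmap x, ← hmc x]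
      have hε : ε₂ = -ε₁ := hpar_ne hpar
      have hm₁' : ‖-m₁‖ = 1 := by rw [norm_neg, hm₁]
      have hmm : -m₁ = m₂ := by
        refine twinDozen_normal_eq_self (F κ₂) hm₁' hm₂ ?_ menu₂ ?_ emp₂
        · intro w hw
          rw [hmap' w, inner_neg_right, inner_mirror_self hm₁, neg_neg]; exact menu₁ w hw
        · intro w hw hle
          rw [hmap' w, inner_neg_right, inner_mirror_self hm₁, neg_neg] at hle
          rw [hmap' w]
          rcases lt_or_eq_of_le hle with hlt | h0
          · exact mir₁ w hw hlt
          · rw [h0, mul_zero, zero_smul, sub_zero]; exact own₁ w hw hle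
      rw [← hmm] at hc₂
      set z₁ : EuclideanSpace ℝ (Fin 3) := F κ₁ (ε₁ • r₁) with hz₁
      set z₂ : EuclideanSpace ℝ (Fin 3) := F κ₁ (ε₁ • r₂) with hz₂
      have hd₁' : d₁ = z₁ := hd₁
      have hRneg : ∀ y : EuclideanSpace ℝ (Fin 3),
          (-y) - (2 * ⟪-y, m₁⟫_ℝ) • m₁ = -(y - (2 * ⟪y, m₁⟫_ℝ) • m₁) := by
        intro y; rw [inner_neg_left]; module
      have hd₂' : d₂ = -(z₂ - (2 * ⟪z₂, m₁⟫_ℝ) • m₁) := by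
        rw [hd₂, hmap', hε, neg_smul, map_neg, hRneg]
      have hRR : ∀ x : EuclideanSpace ℝ (Fin 3), (x - (2 * ⟪x, -m₁⟫_ℝ) • (-m₁)) = x - (2 * ⟪x, m₁⟫_ℝ) • m₁ :=
        fun x => reflect_neg_eq x m₁
      have hRsmul : ∀ (c : ℝ) (x : EuclideanSpace ℝ (Fin 3)),
          (c • x) - (2 * ⟪c • x, μ₁⟫_ℝ) • μ₁ = c • (x - (2 * ⟪x, μ₁⟫_ℝ) • μ₁) := by
        intro c x; rw [real_inner_smul_left]; module
      have hRz₁ : z₁ - (2 * ⟪z₁, m₁⟫_ℝ) • m₁ = F κ₁ (ε₁ • (r₁ - (2 * ⟪r₁, μ₁⟫_ℝ) • μ₁)) := by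
        rw [hz₁, hmc, hRsmul]
      have hobl : ⟪z₁, m₁⟫_ℝ = Real.sqrt (2 / 3) → ⟪r₁, μ₁⟫_ℝ = Real.sqrt (2 / 3) ∨ ⟪r₁, μ₁⟫_ℝ = -Real.sqrt (2 / 3) := by
        intro h
        rw [hz₁, ← hFμ, LinearIsometryEquiv.inner_map_map, real_inner_smul_left] at h
        rcases neg_one_pow_eq_or ℝ κ₁.length with e | e
        · left; rw [hε₁, e, one_mul] at h; exact h
        · right; rw [hε₁, e, neg_one_mul] at h; linarith
      have ht₂ : ∀ {t : EuclideanSpace ℝ (Fin 3)},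
          ((⟪d₂, -m₁⟫_ℝ = Real.sqrt (2 / 3) ∧ t = p - (d₂ - (2 * ⟪d₂, -m₁⟫_ℝ) • (-m₁))) ∨
            (⟪d₂, -m₁⟫_ℝ = 0 ∧ t = p + d₂)) → t = p + z₂ ∨ t = p - z₂ := by
        intro t ht
        rcases ht with ⟨-, rfl⟩ | ⟨hg, rfl⟩
        · left
          rw [hRR, hd₂', hRneg, reflect_reflect_unit hm₁, sub_neg_eq_add]
        · right
          rw [inner_neg_right, neg_eq_zero, hd₂', inner_neg_left, neg_eq_zero, inner_mirror_self hm₁, neg_eq_zero] at hg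
          rw [hd₂', hg, mul_zero, zero_smul, sub_zero, sub_eq_add_neg]
      rw [hd₁'] at hc₁
      rcases hc₁ with ⟨hx₁, rfl⟩ | ⟨hg₁, rfl⟩ <;> rcases ht₂ hc₂ with e | e <;> rw [e] at heq
      · -- cross / cross: `R z₁ = −z₂` ⇒ `R_{μ₁} r₁ = −r₂`
        have h : z₁ - (2 * ⟪z₁, m₁⟫_ℝ) • m₁ = -z₂ := by
          have := heq; rw [sub_eq_add_neg] at this; exact (neg_eq_iff_eq_neg.1 (add_left_cancel this)).symm ▸ rfl
        rw [hRz₁, hz₂, ← map_neg, ← smul_neg] at h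
        have key := smul_right_injective _ hε₁0 ((F κ₁).injective h)
        exact (reflect_oblique_ne_slot hr₁ hr₂ (hobl hx₁)).2 key
      · -- cross / glide: `R z₁ = z₂` ⇒ `R_{μ₁} r₁ = r₂`
        have h : z₁ - (2 * ⟪z₁, m₁⟫_ℝ) • m₁ = z₂ := by
          have := heq; rw [sub_eq_add_neg, sub_eq_add_neg] at this
          exact neg_injective (add_left_cancel this)
        rw [hRz₁, hz₂] at h
        have key := smul_right_injective _ hε₁0 ((F κ₁).injective h)
        exact (reflect_oblique_ne_slot hr₁ hr₂ (hobl hx₁)).1 key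
      · -- glide / cross: `z₁ = z₂`
        exact hdiff (F κ₁) (add_left_cancel heq)
      · -- glide / glide: `z₁ = −z₂` ⇒ `r₁ = −r₂`
        have h : z₁ = -z₂ := by rw [sub_eq_add_neg] at heq; exact add_left_cancel heq
        rw [hz₁, hz₂, ← map_neg, ← smul_neg] at h
        exact hne' (smul_right_injective _ hε₁0 ((F κ₁).injective h))

end TwoFamilies

end Summit.Ventures.Crystal3D.Theorems

end
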